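import Mathlib
import Summits.QuantumFields.QCD.Theorems.PauliWegnerSeaTiltedFlatness
import Summits.QuantumFields.QCD.Theorems.PauliWegnerSeaPhaseQuenchedFlavourDecayWilsonDetNegMoment
import Summits.QuantumFields.QCD.Theorems.PauliWegnerSeaPhaseQuenchedFlavourDecayTiltedNegMoment
import Summits.QuantumFields.QCD.Theorems.PauliWegnerSeaPhaseQuenchedFlavourDecayPiResample
import Summits.QuantumFields.QCD.Theorems.PauliWegnerSeaPhaseQuenchedFlavourDecayTwoStarFlatnessPackage
import Literature.MathematicalPhysics.QuantumFieldTheory.QCDPhaseQuenched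

/-!
# Fibre moment reduction of the minor-form core
(lead c5, line `crossing-split-integrability`, crux stmt-QuantumFields-9151 `PauliWegnerSea.PhaseQuenchedFlavourDecay`)

The open core of the crux (Signature B, registered stub `stub_minorMomentsCore`) asks for volume- and k-uniform
phase-quenched `(1+ε)`-moments of the Wick minors of the Wilson quark propagator.  By Jacobi, a Wick minor of
flavour `f` times `|det D_f|` is a complementary minor of `D_f`, a POLYNOMIAL in the links; so every such moment
is of the form `∫ Ψ^{1+ε} · (|det D_f| · ∏_{g≠f}|det D_g| · e^{-βS}) dHaar` with `Ψ · |det D_f| ≤ A` for a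
bounded `A`.  This file proves the **fibre moment reduction**

  `∫ Ψ^{1+ε} ρ dHaar ≤ K · ∫ (A / M_f)^{1+ε} ρ dHaar`,   `ρ := |det D_f| · ∏_{g≠f}|det D_g| · e^{-βS}`,

for every measurable `Ψ ≥ 0` and every measurable majorant `A ≥ Ψ·|det D_f|` that is INVARIANT along the
two-star fibres of `TiltedFlatness` (links of `star x ∪ star y` free, the rest frozen), where
`M_f(U) := (∫ |det D_f| G w dW) / (∫ G w dW)` is the fibre mean of `|det D_f|` under the law tilted by the other
flavours `G = ∏_{g≠f}|det D_g|` and the gauge weight `w = e^{-βS}` — uniformly in the volume `L ≥ 4`, the sites,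
the background, for `β ∈ [0, β_max]`, masses in `[-2,2]`, and `0 < ε < ε₀(N_f, β_max)`, with `K = K(N_f, β_max, ε)`.
Dividing by `Z = ∫ ρ` this reads: the `(1+ε)`-moment of the Wick minor under the phase-quenched measure is bounded
by the `(1+ε)`-moment of the two-star COFACTOR-TO-DETERMINANT RATIO `A/M_f` — the object of the route's crux
K1 (`FibreCofactorDomination`, stmt-11510: a SUP bound `sup_W |adj| ≤ C₀(1+n_w) sup_W |det|` with the global
in-window count `n_w`), here in the MOMENT form that the minor-form core actually needs (no `n_w`, an average over
the outside field instead of a supremum; lead c1's aligned nilpotent corner shows that no bound uniform in the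
outside can hold for one star).  The only loss is the constant `K(N_f, β_max, ε)`.

Inputs (all landed, this namespace): `stub_tiltedNegMoment` (negative moments under a doubly tilted law from
flatness + relative small balls; p118965), `stub_piResample` (resampling identity for product probability measures;
p118773), `stub_twoStarFlatnessPackage` (the PROVED `TiltedFlatness`, stmt-14070, repackaged for one flavour and
for the product of the others).  Proof: resample the star links (`∫ Φ = ∫_U ∫_W Φ(refit U W)`), estimate each
fibre (`Ψ^{1+ε}|det D_f| ≤ A^{1+ε}|det D_f|^{-ε}` pointwise, then the tilted negative moment
`∫ G w |det D_f|^{-ε} ≤ K (∫Gw)^{1+ε}(∫|det D_f| G w)^{-ε}`), and resample back.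
-/

noncomputable section

namespace Summit.QuantumFields.QCD.Cruxes.PhaseQuenchedFlavourDecay.CrossingSplitIntegrability

open scoped BigOperators ENNReal
open MeasureTheory Filter
open Literature.MathematicalPhysics.QuantumFieldTheory Literature.MathematicalPhysics.QuantumLattice
  Literature.Probability.LatticeModels

/-- Pointwise step of the fibre estimate: if `ψ F ≤ a` then
`ψ^{1+ε} (F g) ≤ a^{1+ε} · g · F^{-ε}`, in `ℝ≥0∞` (both sides vanish/absorb correctly at `F = 0`). -/
theorem ofReal_rpow_mul_le_of_mul_le {ψ F g a ε : ℝ} (hψ : 0 ≤ ψ) (hF : 0 ≤ F) (hg : 0 ≤ g)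
    (ha : 0 ≤ a) (hψF : ψ * F ≤ a) (hε : 0 < ε) :
    ENNReal.ofReal (ψ ^ (1 + ε) * (F * g)) ≤
      ENNReal.ofReal (a ^ (1 + ε)) * (ENNReal.ofReal g * ENNReal.ofReal F ^ (-ε)) := by
  rcases hF.eq_or_lt with hF0 | hFpos
  · rw [← hF0]; simp
  · have hε1 : 0 < 1 + ε := by linarith
    have h1 : ψ ^ (1 + ε) * F = (ψ * F) ^ (1 + ε) * F ^ (-ε) := by
      rw [Real.mul_rpow hψ hF, Real.rpow_neg hF, mul_assoc, Real.rpow_add hFpos, Real.rpow_one,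
        mul_assoc, mul_inv_cancel₀ (Real.rpow_pos_of_pos hFpos _).ne', mul_one]
    have h2 : (ψ * F) ^ (1 + ε) ≤ a ^ (1 + ε) := Real.rpow_le_rpow (mul_nonneg hψ hF) hψF hε1.le
    have hreal : ψ ^ (1 + ε) * (F * g) ≤ a ^ (1 + ε) * (g * F ^ (-ε)) := by
      calc ψ ^ (1 + ε) * (F * g) = (ψ ^ (1 + ε) * F) * g := by ring
        _ = (ψ * F) ^ (1 + ε) * F ^ (-ε) * g := by rw [h1]
        _ ≤ a ^ (1 + ε) * F ^ (-ε) * g :=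
            mul_le_mul_of_nonneg_right (mul_le_mul_of_nonneg_right h2 (Real.rpow_nonneg hF _)) hg
        _ = a ^ (1 + ε) * (g * F ^ (-ε)) := by ring
    calc ENNReal.ofReal (ψ ^ (1 + ε) * (F * g))
        ≤ ENNReal.ofReal (a ^ (1 + ε) * (g * F ^ (-ε))) := ENNReal.ofReal_le_ofReal hreal
      _ = ENNReal.ofReal (a ^ (1 + ε)) * (ENNReal.ofReal g * ENNReal.ofReal F ^ (-ε)) := by
          rw [ENNReal.ofReal_mul (Real.rpow_nonneg ha _), ENNReal.ofReal_mul hg,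
            ENNReal.ofReal_rpow_of_pos hFpos]

/-- Real-number bookkeeping of the fibre estimate:
`a^{1+ε} · (K · I_G^{1+ε} · I_{FG}^{-ε}) = K · (a / (I_{FG}/I_G))^{1+ε} · I_{FG}`. -/
theorem rpow_mul_fibreConst_eq {a K IG IFG ε : ℝ} (ha : 0 ≤ a) (hIG : 0 < IG) (hIFG : 0 < IFG) :
    a ^ (1 + ε) * (K * IG ^ (1 + ε) * IFG ^ (-ε)) = K * (a / (IFG / IG)) ^ (1 + ε) * IFG := by
  rw [Real.div_rpow ha (div_nonneg hIFG.le hIG.le), Real.div_rpow hIFG.le hIG.le, Real.rpow_neg hIFG.le,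
    Real.rpow_add hIFG, Real.rpow_one]
  have hIGne : IG ^ (1 + ε) ≠ 0 := (Real.rpow_pos_of_pos hIG _).ne'
  have hIFGε : IFG ^ ε ≠ 0 := (Real.rpow_pos_of_pos hIFG _).ne'
  have hIFGne : IFG ≠ 0 := hIFG.ne'
  field_simp

/-- **Fibre moment reduction, Of-form**: the statement of `fibreMomentReduction` from its three inputs taken as
hypotheses — the abstract tilted negative-moment bound (`stub_tiltedNegMoment`), the resampling identity for product
probability measures (`stub_piResample`) and the two-star flatness package of the proved `TiltedFlatness`
(`twoStarFlatnessPackage`).  Proof: resample the star links, bound each fibre (pointwise `Ψ^{1+ε}|det D_f| ≤ A^{1+ε}|det D_f|^{-ε}`,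
then the tilted negative moment), pull the fibre-invariant factor `K (A/M_f)^{1+ε}` out and resample back. -/
theorem fibreMomentReduction_of :
    (∀ (C c ε : ℝ), 0 < C → 0 < c → 0 < ε → ε < c → ∃ K : ℝ, 0 < K ∧ ∀ (Ω : Type) [MeasurableSpace Ω] (μ : MeasureTheory.Measure Ω) [MeasureTheory.IsProbabilityMeasure μ] (w F G : Ω → ℝ), Measurable w → Measurable F → Measurable G → (∀ ω, 0 ≤ w ω) → (∀ ω, 0 ≤ F ω) → (∀ ω, 0 ≤ G ω) → (∃ B : ℝ, ∀ ω, w ω ≤ B ∧ F ω ≤ B ∧ G ω ≤ B) → 0 < ∫ ω, F ω * G ω * w ω ∂μ → (∀ ω, F ω * ∫ ω', w ω' ∂μ ≤ C * ∫ ω', F ω' * w ω' ∂μ) → (∀ ω, G ω * ∫ ω', w ω' ∂μ ≤ C * ∫ ω', G ω' * w ω' ∂μ) → (∀ η : ℝ, 0 < η → ∫ ω, (if F ω * ∫ ω', w ω' ∂μ ≤ η * ∫ ω', F ω' * w ω' ∂μ then (1 : ℝ) else 0) * w ω ∂μ ≤ C * η ^ c * ∫ ω', w ω' ∂μ) → ∫⁻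 ω, ENNReal.ofReal (G ω * w ω) * ENNReal.ofReal (F ω) ^ (-ε) ∂μ ≤ ENNReal.ofReal (K * (∫ ω, G ω * w ω ∂μ) ^ (1 + ε) * (∫ ω, F ω * G ω * w ω ∂μ) ^ (-ε))) → (∀ (ι : Type) [Fintype ι] [DecidableEq ι] (X : Type) [MeasurableSpace X] (μ : MeasureTheory.Measure X) [MeasureTheory.IsProbabilityMeasure μ] (p : ι → Prop) [DecidablePred p] (Φ : (ι → X) → ENNReal), Measurable Φ → ∫⁻ x, Φ x ∂(MeasureTheory.Measure.pi fun _ : ι => μ) = ∫⁻ x, ∫⁻ y, Φ (fun i => if p i then y i else x i) ∂(MeasureTheory.Measure.pi fun _ : ι => μ) ∂(MeasureTheory.Measure.pi fun _ : ι => μ)) → (∀ (Nf : ℕ) (βmax : ℝ), 0 ≤ βmax → ∃ C c : ℝ, 0 < C ∧ 0 < c ∧ ∀ β : ℝ, 0 ≤ β → β ≤ βmax → ∀ mq : Fin Nf → ℝ, (∀ f, -2 ≤ mq f ∧ mq f ≤ 2) → ∀ (L : ℕ) [NeZero L], 4 ≤ L → ∀ (U : GaugeConfig 4 L (Matrix.specialUnitaryGroup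 (Fin 3) ℂ)) (x y : TorusSite 4 L) (f : Fin Nf), let star : Edge 4 L → Prop := fun e => e.1 = x ∨ Site.shift e.1 e.2 = x ∨ e.1 = y ∨ Site.shift e.1 e.2 = y; let refit : GaugeConfig 4 L (Matrix.specialUnitaryGroup (Fin 3) ℂ) → GaugeConfig 4 L (Matrix.specialUnitaryGroup (Fin 3) ℂ) := fun W e => if star e then W e else U e; let Ff : GaugeConfig 4 L (Matrix.specialUnitaryGroup (Fin 3) ℂ) → ℝ := fun W => ‖fermionDet (wilsonDirac (fundamentalRep (Fin 3)) (refit W) (mq f) 1)‖; let G : GaugeConfig 4 L (Matrix.specialUnitaryGroup (Fin 3) ℂ) → ℝ := fun W => ∏ g ∈ Finset.univ.erase f, ‖fermionDet (wilsonDirac (fundamentalRep (Fin 3)) (refit W) (mq g) 1)‖; let wt : GaugeConfig 4 L (Matrix.specialUnitaryGroup (Fin 3) ℂ) → ℝ := fun W => Real.exp (-(β * wilsonAction (fundamentalRep (Fin 3)) (refit W))); let haar : Measure (GaugeConfig 4 L (Matrix.specialUnitaryGroup (Fin 3) ℂ)) := Measure.pi fun _ => haarProbability (Matrix.specialUnitaryGroup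 (Fin 3) ℂ); (∀ W₀ : GaugeConfig 4 L (Matrix.specialUnitaryGroup (Fin 3) ℂ), Ff W₀ * ∫ W, wt W ∂haar ≤ C * ∫ W, Ff W * wt W ∂haar) ∧ (∀ W₀ : GaugeConfig 4 L (Matrix.specialUnitaryGroup (Fin 3) ℂ), G W₀ * ∫ W, wt W ∂haar ≤ C * ∫ W, G W * wt W ∂haar) ∧ (0 < ∫ W, Ff W * wt W ∂haar → ∀ η : ℝ, 0 < η → ∫ W, (if Ff W * ∫ W', wt W' ∂haar ≤ η * ∫ W', Ff W' * wt W' ∂haar then (1 : ℝ) else 0) * wt W ∂haar ≤ C * η ^ c * ∫ W', wt W' ∂haar)) → ∀ (Nf : ℕ) (βmax : ℝ), 0 ≤ βmax → ∃ ε₀ : ℝ, 0 < ε₀ ∧ ∀ ε : ℝ, 0 < ε → ε < ε₀ → ∃ K : ℝ, 0 < K ∧ ∀ β : ℝ, 0 ≤ β → β ≤ βmax → ∀ mq : Fin Nf → ℝ, (∀ f, -2 ≤ mq f ∧ mq f ≤ 2) → ∀ (L : ℕ) [NeZero L], 4 ≤ L → ∀ (f : Fin Nf) (x y : TorusSite 4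 L) (Ψ A : GaugeConfig 4 L SU3 → ℝ), Measurable Ψ → Measurable A → (∀ U, 0 ≤ Ψ U) → (∀ U, 0 ≤ A U) → let star : Edge 4 L → Prop := fun e => e.1 = x ∨ Site.shift e.1 e.2 = x ∨ e.1 = y ∨ Site.shift e.1 e.2 = y; let refit : GaugeConfig 4 L SU3 → GaugeConfig 4 L SU3 → GaugeConfig 4 L SU3 := fun U W e => if star e then W e else U e; let Ff : GaugeConfig 4 L SU3 → ℝ := fun U => ‖fermionDet (wilsonDirac (fundamentalRep (Fin 3)) U (mq f) 1)‖; let G : GaugeConfig 4 L SU3 → ℝ := fun U => ∏ g ∈ Finset.univ.erase f, ‖fermionDet (wilsonDirac (fundamentalRep (Fin 3)) U (mq g) 1)‖; let wt : GaugeConfig 4 L SU3 → ℝ := fun U => Real.exp (-(β * wilsonAction (fundamentalRep (Fin 3)) U)); let haar : Measure (GaugeConfig 4 L SU3) := Measure.pi fun _ => haarProbability SU3; let M : GaugeConfig 4 L SU3 → ℝ := fun U => (∫ W, Ff (refit U W) * G (refit U W) * wt (refit U W) ∂haar) / ∫ W, G (refit U W) * wt (refit U W) ∂haar; (∀ U,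 Ψ U * Ff U ≤ A U) → (∀ U W, A (refit U W) = A U) → ∫⁻ U, ENNReal.ofReal (Ψ U ^ (1 + ε) * (Ff U * G U * wt U)) ∂haar ≤ ENNReal.ofReal K * ∫⁻ U, ENNReal.ofReal ((A U / M U) ^ (1 + ε) * (Ff U * G U * wt U)) ∂haar := by
  intro hNeg hRes hPkg Nf βmax hβmax
  obtain ⟨C, c, hC, hc, hP⟩ := hPkg Nf βmax hβmax
  refine ⟨c, hc, fun ε hε hεc => ?_⟩
  obtain ⟨K, hK, hN⟩ := hNeg C c ε hC hc hε hεc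
  refine ⟨K, hK, ?_⟩
  intro β hβ hββ mq hmq L _ hL f x y Ψ A hΨm hAm hΨ0 hA0 star refit Ff G wt haar M hdom hinv
  -- ### instances and basic facts
  haveI : IsProbabilityMeasure haar := by
    dsimp only [haar]; infer_instance
  have hρ3 : Continuous (fundamentalRep (Fin 3) : SU3 →* Matrix (Fin 3) (Fin 3) ℂ) :=
    continuous_fundamentalRep (Fin 3)
  -- continuity of the three weights
  have hFf_cont : Continuous Ff := continuous_norm_det_wilsonDirac (L := L) (mq f)
  have hG_cont : Continuous G :=
    continuous_finsetProd _ fun g _ => continuous_norm_det_wilsonDirac (L := L) (mq g)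
  have hwt_cont : Continuous wt :=
    (continuous_const.mul (continuous_wilsonAction (fundamentalRep (Fin 3)) hρ3)).neg.rexp
  -- joint continuity of the refit map
  have hrefit_cont : Continuous fun p : GaugeConfig 4 L SU3 × GaugeConfig 4 L SU3 => refit p.1 p.2 := by
    refine continuous_pi fun e => ?_
    by_cases he : star e
    · have : (fun p : GaugeConfig 4 L SU3 × GaugeConfig 4 L SU3 => refit p.1 p.2 e) = fun p => p.2 e := by
        funext p; simp [refit, he]
      rw [this]; exact (continuous_apply e).comp continuous_snd
    · have : (fun p : GaugeConfig 4 L SU3 × GaugeConfig 4 L SU3 => refit p.1 p.2 e) = fun p => p.1 e := by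
        funext p; simp [refit, he]
      rw [this]; exact (continuous_apply e).comp continuous_fst
  have hrefitU_cont : ∀ U : GaugeConfig 4 L SU3, Continuous (refit U) := fun U =>
    hrefit_cont.comp (Continuous.prodMk_right U)
  -- nonnegativity
  have hFf0 : ∀ U, 0 ≤ Ff U := fun U => norm_nonneg _
  have hG0 : ∀ U, 0 ≤ G U := fun U => Finset.prod_nonneg fun g _ => norm_nonneg _
  have hwt0 : ∀ U, 0 < wt U := fun U => Real.exp_pos _
  -- uniform bounds (compact configuration space)
  obtain ⟨BF, hBF⟩ : ∃ B : ℝ, ∀ U, Ff U ≤ B := by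
    obtain ⟨B, hB⟩ := isCompact_univ.bddAbove_image hFf_cont.continuousOn
    exact ⟨B, fun U => hB ⟨U, Set.mem_univ _, rfl⟩⟩
  obtain ⟨BG, hBG⟩ : ∃ B : ℝ, ∀ U, G U ≤ B := by
    obtain ⟨B, hB⟩ := isCompact_univ.bddAbove_image hG_cont.continuousOn
    exact ⟨B, fun U => hB ⟨U, Set.mem_univ _, rfl⟩⟩
  obtain ⟨BW, hBW⟩ : ∃ B : ℝ, ∀ U, wt U ≤ B := by
    obtain ⟨B, hB⟩ := isCompact_univ.bddAbove_image hwt_cont.continuousOn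
    exact ⟨B, fun U => hB ⟨U, Set.mem_univ _, rfl⟩⟩
  -- refit is idempotent along a fibre, hence `M` and `A` are fibre-invariant
  have hrefit_refit : ∀ U W W' : GaugeConfig 4 L SU3, refit (refit U W) W' = refit U W' := by
    intro U W W'; funext e; by_cases he : star e <;> simp [refit, he]
  have hM_inv : ∀ U W, M (refit U W) = M U := by
    intro U W; simp only [M, hrefit_refit]
  -- ### measurability
  have hFf_m : Measurable Ff := hFf_cont.measurable
  have hG_m : Measurable G := hG_cont.measurable
  have hwt_m : Measurable wt := hwt_cont.measurable
  set ρ : GaugeConfig 4 L SU3 → ℝ := fun U => Ff U * G U * wt U with hρdef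
  have hρ_cont : Continuous ρ := (hFf_cont.mul hG_cont).mul hwt_cont
  have hρ0 : ∀ U, 0 ≤ ρ U := fun U => mul_nonneg (mul_nonneg (hFf0 U) (hG0 U)) (hwt0 U).le
  -- the parametric fibre integrals are measurable in the outside field
  have hnum_m : Measurable fun U => ∫ W, Ff (refit U W) * G (refit U W) * wt (refit U W) ∂haar := by
    have hc : Continuous fun p : GaugeConfig 4 L SU3 × GaugeConfig 4 L SU3 => ρ (refit p.1 p.2) :=
      hρ_cont.comp hrefit_cont
    exact (hc.stronglyMeasurable.integral_prod_right' (ν := haar)).measurable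
  have hden_m : Measurable fun U => ∫ W, G (refit U W) * wt (refit U W) ∂haar := by
    have hc : Continuous fun p : GaugeConfig 4 L SU3 × GaugeConfig 4 L SU3 =>
        G (refit p.1 p.2) * wt (refit p.1 p.2) := (hG_cont.mul hwt_cont).comp hrefit_cont
    exact (hc.stronglyMeasurable.integral_prod_right' (ν := haar)).measurable
  have hM_m : Measurable M := hnum_m.div hden_m
  -- the two integrands of the statement, as `ℝ≥0∞`-valued measurable functions
  set Φ : GaugeConfig 4 L SU3 → ℝ≥0∞ := fun U => ENNReal.ofReal (Ψ U ^ (1 + ε) * ρ U) with hΦdef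
  set Φ' : GaugeConfig 4 L SU3 → ℝ≥0∞ := fun U => ENNReal.ofReal (K * (A U / M U) ^ (1 + ε) * ρ U)
    with hΦ'def
  have hΦ_m : Measurable Φ := ((hΨm.pow_const _).mul hρ_cont.measurable).ennreal_ofReal
  have hΦ'_m : Measurable Φ' :=
    ((measurable_const.mul ((hAm.div hM_m).pow_const _)).mul hρ_cont.measurable).ennreal_ofReal
  -- ### the fibre estimate
  have key : ∀ U : GaugeConfig 4 L SU3,
      ∫⁻ W, Φ (refit U W) ∂haar ≤
        ENNReal.ofReal (K * (A U / M U) ^ (1 + ε)) * ∫⁻ W, ENNReal.ofReal (ρ (refit U W)) ∂haar := by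
    intro U
    -- the three weights along the fibre of `U`
    set F : GaugeConfig 4 L SU3 → ℝ := fun W => Ff (refit U W) with hFdef
    set Gf : GaugeConfig 4 L SU3 → ℝ := fun W => G (refit U W) with hGfdef
    set w : GaugeConfig 4 L SU3 → ℝ := fun W => wt (refit U W) with hwdef
    have hF_m : Measurable F := hFf_m.comp (hrefitU_cont U).measurable
    have hGf_m : Measurable Gf := hG_m.comp (hrefitU_cont U).measurable
    have hw_m : Measurable w := hwt_m.comp (hrefitU_cont U).measurable
    have hF0' : ∀ W, 0 ≤ F W := fun W => hFf0 _
    have hGf0' : ∀ W, 0 ≤ Gf W := fun W => hG0 _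
    have hw0' : ∀ W, 0 ≤ w W := fun W => (hwt0 _).le
    have hFGw0 : ∀ W, 0 ≤ F W * Gf W * w W := fun W =>
      mul_nonneg (mul_nonneg (hF0' W) (hGf0' W)) (hw0' W)
    have hρ_refit : ∀ W, ρ (refit U W) = F W * Gf W * w W := fun W => rfl
    -- integrability of the (bounded, measurable) fibre weights
    have hFGw_int : Integrable (fun W => F W * Gf W * w W) haar := by
      refine Integrable.of_bound ((hF_m.mul hGf_m).mul hw_m).aestronglyMeasurable (BF * BG * BW)
        (ae_of_all _ fun W => ?_)
      rw [Real.norm_eq_abs, abs_of_nonneg (hFGw0 W)]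
      have hBF0 : 0 ≤ BF := (hFf0 (refit U W)).trans (hBF _)
      have hBG0 : 0 ≤ BG := (hG0 (refit U W)).trans (hBG _)
      exact mul_le_mul (mul_le_mul (hBF _) (hBG _) (hGf0' W) hBF0) (hBW _) (hw0' W)
        (mul_nonneg hBF0 hBG0)
    by_cases hpos : 0 < ∫ W, F W * Gf W * w W ∂haar
    · -- the flatness / small-ball package of the proved `TiltedFlatness` on this fibre
      have pkg := hP β hβ hββ mq hmq L hL U x y f
      obtain ⟨hflatF, hflatG, hsb⟩ := pkg
      -- positivity of the one-flavour weight (from `G ≤ BG`)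
      have hBG0 : 0 ≤ BG := (hG0 (refit U U)).trans (hBG _)
      have hFw_int : Integrable (fun W => F W * w W) haar := by
        refine Integrable.of_bound (hF_m.mul hw_m).aestronglyMeasurable (BF * BW)
          (ae_of_all _ fun W => ?_)
        rw [Real.norm_eq_abs, abs_of_nonneg (mul_nonneg (hF0' W) (hw0' W))]
        exact mul_le_mul (hBF _) (hBW _) (hw0' W) ((hFf0 (refit U W)).trans (hBF _))
      have hIFpos : 0 < ∫ W, F W * w W ∂haar := by
        have hle : ∫ W, F W * Gf W * w W ∂haar ≤ BG * ∫ W, F W * w W ∂haar := by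
          rw [← integral_const_mul]
          refine integral_mono hFGw_int (hFw_int.const_mul _) fun W => ?_
          have : F W * Gf W * w W = Gf W * (F W * w W) := by ring
          rw [this]
          exact mul_le_mul_of_nonneg_right (hBG _) (mul_nonneg (hF0' W) (hw0' W))
        by_contra hneg
        have h0 : ∫ W, F W * w W ∂haar ≤ 0 := not_lt.1 hneg
        have : ∫ W, F W * Gf W * w W ∂haar ≤ 0 :=
          hle.trans (mul_nonpos_of_nonneg_of_nonpos hBG0 h0) |>.trans (le_refl _)
        exact absurd this (not_le.2 hpos)
      -- the abstract tilted negative-moment bound on this fibre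
      have hmain := hN (GaugeConfig 4 L SU3) haar w F Gf hw_m hF_m hGf_m hw0' hF0' hGf0'
        ⟨max BW (max BF BG), fun W => ⟨(hBW _).trans (le_max_left _ _),
          (hBF _).trans ((le_max_left _ _).trans (le_max_right _ _)),
          (hBG _).trans ((le_max_right _ _).trans (le_max_right _ _))⟩⟩
        hpos hflatF hflatG (hsb hIFpos)
      -- abbreviations for the two fibre integrals
      set IG : ℝ := ∫ W, Gf W * w W ∂haar with hIGdef
      set IFG : ℝ := ∫ W, F W * Gf W * w W ∂haar with hIFGdef
      have hIGpos : 0 < IG := by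
        have hle : IFG ≤ BF * IG := by
          rw [hIGdef, ← integral_const_mul]
          have hGw_int : Integrable (fun W => Gf W * w W) haar := by
            refine Integrable.of_bound (hGf_m.mul hw_m).aestronglyMeasurable (BG * BW)
              (ae_of_all _ fun W => ?_)
            rw [Real.norm_eq_abs, abs_of_nonneg (mul_nonneg (hGf0' W) (hw0' W))]
            exact mul_le_mul (hBG _) (hBW _) (hw0' W) hBG0
          refine integral_mono hFGw_int (hGw_int.const_mul _) fun W => ?_
          have : F W * Gf W * w W = F W * (Gf W * w W) := by ring
          rw [this]
          exact mul_le_mul_of_nonneg_right (hBF _) (mul_nonneg (hGf0' W) (hw0' W))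
        by_contra hneg
        have hBF0 : 0 ≤ BF := (hFf0 (refit U U)).trans (hBF _)
        have : IFG ≤ 0 := hle.trans (mul_nonpos_of_nonneg_of_nonpos hBF0 (not_lt.1 hneg))
        exact absurd this (not_le.2 hpos)
      have hMU : M U = IFG / IG := rfl
      -- pointwise domination of `Φ ∘ refit U` by the tilted negative power
      have hpt : ∀ W, Φ (refit U W) ≤
          ENNReal.ofReal (A U ^ (1 + ε)) * (ENNReal.ofReal (Gf W * w W) * ENNReal.ofReal (F W) ^ (-ε)) := by
        intro W
        have hΨF : Ψ (refit U W) * F W ≤ A U := by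
          have := hdom (refit U W); rwa [hinv U W] at this
        have h := ofReal_rpow_mul_le_of_mul_le (hΨ0 (refit U W)) (hF0' W) (mul_nonneg (hGf0' W) (hw0' W))
          (hA0 U) hΨF hε
        simpa only [hΦdef, hρ_refit, mul_assoc] using h
      -- measurability of the dominating integrand
      have hdm : Measurable fun W => ENNReal.ofReal (Gf W * w W) * ENNReal.ofReal (F W) ^ (-ε) :=
        (hGf_m.mul hw_m).ennreal_ofReal.mul (hF_m.ennreal_ofReal.pow_const _)
      have halg : A U ^ (1 + ε) * (K * IG ^ (1 + ε) * IFG ^ (-ε)) = K * (A U / M U) ^ (1 + ε) * IFG := by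
        rw [hMU]; exact rpow_mul_fibreConst_eq (hA0 U) hIGpos hpos
      calc ∫⁻ W, Φ (refit U W) ∂haar
          ≤ ∫⁻ W, ENNReal.ofReal (A U ^ (1 + ε)) *
              (ENNReal.ofReal (Gf W * w W) * ENNReal.ofReal (F W) ^ (-ε)) ∂haar := lintegral_mono hpt
        _ = ENNReal.ofReal (A U ^ (1 + ε)) *
              ∫⁻ W, ENNReal.ofReal (Gf W * w W) * ENNReal.ofReal (F W) ^ (-ε) ∂haar :=
            lintegral_const_mul _ hdm
        _ ≤ ENNReal.ofReal (A U ^ (1 + ε)) * ENNReal.ofReal (K * IG ^ (1 + ε) * IFG ^ (-ε)) :=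
            mul_le_mul_right hmain _
        _ = ENNReal.ofReal (K * (A U / M U) ^ (1 + ε)) * ENNReal.ofReal IFG := by
            rw [← ENNReal.ofReal_mul (Real.rpow_nonneg (hA0 U) _), halg,
              ENNReal.ofReal_mul (mul_nonneg hK.le (Real.rpow_nonneg (div_nonneg (hA0 U)
                (div_nonneg hpos.le hIGpos.le)) _))]
        _ = ENNReal.ofReal (K * (A U / M U) ^ (1 + ε)) * ∫⁻ W, ENNReal.ofReal (ρ (refit U W)) ∂haar := by
            rw [hIFGdef, ofReal_integral_eq_lintegral_ofReal hFGw_int (ae_of_all _ hFGw0)]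
    · -- degenerate fibre: the phase-quenched weight vanishes a.e. along it, and so does `Φ`
      have hzero : ∫ W, F W * Gf W * w W ∂haar = 0 :=
        le_antisymm (not_lt.1 hpos) (integral_nonneg hFGw0)
      have hae : (fun W => F W * Gf W * w W) =ᵐ[haar] 0 :=
        (integral_eq_zero_iff_of_nonneg hFGw0 hFGw_int).1 hzero
      have hΦae : (fun W => Φ (refit U W)) =ᵐ[haar] 0 := by
        filter_upwards [hae] with W hW
        simp only [Pi.zero_apply] at hW ⊢
        simp only [hΦdef, hρ_refit, hW, mul_zero, ENNReal.ofReal_zero]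
      rw [lintegral_congr_ae hΦae]
      simp only [Pi.zero_apply, lintegral_const, zero_mul, zero_le]
  -- ### assembly: resample the star links, estimate fibrewise, resample back
  have hnonnegKAM : ∀ U, 0 ≤ K * (A U / M U) ^ (1 + ε) := fun U =>
    mul_nonneg hK.le (Real.rpow_nonneg (div_nonneg (hA0 U) ?_) _)
  swap
  · -- `0 ≤ M U`
    exact div_nonneg (integral_nonneg fun W => mul_nonneg (mul_nonneg (hFf0 _) (hG0 _)) (hwt0 _).le)
      (integral_nonneg fun W => mul_nonneg (hG0 _) (hwt0 _).le)
  have hstep1 : ∫⁻ U, Φ U ∂haar = ∫⁻ U, ∫⁻ W, Φ (refit U W) ∂haar ∂haar :=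
    hRes (Edge 4 L) SU3 (haarProbability SU3) star Φ hΦ_m
  have hstep3 : ∫⁻ U, Φ' U ∂haar = ∫⁻ U, ∫⁻ W, Φ' (refit U W) ∂haar ∂haar :=
    hRes (Edge 4 L) SU3 (haarProbability SU3) star Φ' hΦ'_m
  have hΦ'_refit : ∀ U W, Φ' (refit U W) =
      ENNReal.ofReal (K * (A U / M U) ^ (1 + ε)) * ENNReal.ofReal (ρ (refit U W)) := by
    intro U W
    simp only [hΦ'def, hinv U W, hM_inv U W]
    rw [ENNReal.ofReal_mul (hnonnegKAM U)]
  have hρm_refit : ∀ U, Measurable fun W => ENNReal.ofReal (ρ (refit U W)) := fun U =>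
    (hρ_cont.measurable.comp (hrefitU_cont U).measurable).ennreal_ofReal
  calc ∫⁻ U, ENNReal.ofReal (Ψ U ^ (1 + ε) * (Ff U * G U * wt U)) ∂haar
      = ∫⁻ U, Φ U ∂haar := rfl
    _ = ∫⁻ U, ∫⁻ W, Φ (refit U W) ∂haar ∂haar := hstep1
    _ ≤ ∫⁻ U, ENNReal.ofReal (K * (A U / M U) ^ (1 + ε)) * ∫⁻ W, ENNReal.ofReal (ρ (refit U W)) ∂haar ∂haar :=
        lintegral_mono key
    _ = ∫⁻ U, ∫⁻ W, Φ' (refit U W) ∂haar ∂haar := by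
        refine lintegral_congr fun U => ?_
        rw [← lintegral_const_mul _ (hρm_refit U)]
        exact lintegral_congr fun W => (hΦ'_refit U W).symm
    _ = ∫⁻ U, Φ' U ∂haar := hstep3.symm
    _ = ∫⁻ U, ENNReal.ofReal K * ENNReal.ofReal ((A U / M U) ^ (1 + ε) * (Ff U * G U * wt U)) ∂haar := by
        refine lintegral_congr fun U => ?_
        simp only [hΦ'def]
        rw [mul_assoc, ENNReal.ofReal_mul hK.le]
    _ = ENNReal.ofReal K * ∫⁻ U, ENNReal.ofReal ((A U / M U) ^ (1 + ε) * (Ff U * G U * wt U)) ∂haar :=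
        lintegral_const_mul _ ((((hAm.div hM_m).pow_const _).mul hρ_cont.measurable).ennreal_ofReal)


/-- **Fibre moment reduction** — the unconditional statement (`let` spelling), by `fibreMomentReduction_of` applied to the
three landed inputs `stub_tiltedNegMoment` (p118965), `stub_piResample` (p118773), `twoStarFlatnessPackage`.  For
`β ∈ [0, β_max]`, masses in `[-2,2]`, `L ≥ 4`, every flavour `f`, sites `x, y`, measurable `Ψ ≥ 0` and fibre-invariant
measurable majorant `A ≥ Ψ · |det D_f|`: `∫ Ψ^{1+ε} ρ dHaar ≤ K ∫ (A/M_f)^{1+ε} ρ dHaar`,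
`ρ = |det D_f| ∏_{g≠f}|det D_g| e^{-βS}`, `0 < ε < ε₀(N_f, β_max)`, `K = K(N_f, β_max, ε)`. -/
theorem fibreMomentReduction :
    ∀ (Nf : ℕ) (βmax : ℝ), 0 ≤ βmax → ∃ ε₀ : ℝ, 0 < ε₀ ∧ ∀ ε : ℝ, 0 < ε → ε < ε₀ → ∃ K : ℝ, 0 < K ∧ ∀ β : ℝ, 0 ≤ β →
    β ≤ βmax → ∀ mq : Fin Nf → ℝ, (∀ f, -2 ≤ mq f ∧ mq f ≤ 2) → ∀ (L : ℕ) [NeZero L], 4 ≤ L → ∀ (f : Fin Nf) (x y : TorusSite 4 L) (Ψ A : GaugeConfig 4 L SU3 →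
    ℝ), Measurable Ψ → Measurable A → (∀ U, 0 ≤ Ψ U) → (∀ U, 0 ≤ A U) →
    let star : Edge 4 L → Prop := fun e => e.1 = x ∨ Site.shift e.1 e.2 = x ∨ e.1 = y ∨ Site.shift e.1 e.2 = y;
    let refit : GaugeConfig 4 L SU3 → GaugeConfig 4 L SU3 → GaugeConfig 4 L SU3 := fun U W e => if star e then W e else U e;
    let Ff : GaugeConfig 4 L SU3 → ℝ := fun U => ‖fermionDet (wilsonDirac (fundamentalRep (Fin 3)) U (mq f) 1)‖;
    let G : GaugeConfig 4 L SU3 → ℝ := fun U => ∏ g ∈ Finset.univ.erase f, ‖fermionDet (wilsonDirac (fundamentalRep (Fin 3)) U (mq g) 1)‖;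
    let wt : GaugeConfig 4 L SU3 → ℝ := fun U => Real.exp (-(β * wilsonAction (fundamentalRep (Fin 3)) U));
    let haar : Measure (GaugeConfig 4 L SU3) := Measure.pi fun _ => haarProbability SU3;
    let M : GaugeConfig 4 L SU3 → ℝ := fun U => (∫ W, Ff (refit U W) * G (refit U W) * wt (refit U W) ∂haar) / ∫ W, G (refit U W) * wt (refit U W) ∂haar;
    (∀ U, Ψ U * Ff U ≤ A U) → (∀ U W, A (refit U W) = A U) → ∫⁻ U, ENNReal.ofReal (Ψ U ^ (1 + ε) * (Ff U * G U * wt U)) ∂haar ≤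
    ENNReal.ofReal K * ∫⁻ U, ENNReal.ofReal ((A U / M U) ^ (1 + ε) * (Ff U * G U * wt U)) ∂haar :=
  fibreMomentReduction_of stub_tiltedNegMoment stub_piResample twoStarFlatnessPackage

/-- Registered stub `stub_fibreMomentReduction` (crux stmt-QuantumFields-9151, line `crossing-split-integrability`): the
LET-FREE spelling of `fibreMomentReduction` (the gate's stub matcher cannot see past a `:=` inside a statement, so the
registered signature inlines `star`, `refit`, `Ff`, `G`, `wt`, `haar`, `M`).  Definitionally the same proposition. -/
theorem stub_fibreMomentReduction :
    ∀ (Nf : ℕ) (βmax : ℝ), 0 ≤ βmax → ∃ ε₀ : ℝ, 0 < ε₀ ∧ ∀ ε : ℝ, 0 < ε → ε < ε₀ → ∃ K : ℝ, 0 < K ∧ ∀ β : ℝ, 0 ≤ β →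
    β ≤ βmax → ∀ mq : Fin Nf → ℝ, (∀ f, -2 ≤ mq f ∧ mq f ≤ 2) → ∀ (L : ℕ) [NeZero L], 4 ≤ L → ∀ (f : Fin Nf) (x y : TorusSite 4 L) (Ψ A : GaugeConfig 4 L SU3 →
    ℝ), Measurable Ψ → Measurable A → (∀ U, 0 ≤ Ψ U) → (∀ U, 0 ≤ A U) → (∀ U, Ψ U * ‖fermionDet (wilsonDirac (fundamentalRep (Fin 3)) U (mq f) 1)‖ ≤
    A U) → (∀ U W : GaugeConfig 4 L SU3, A (fun e => if e.1 = x ∨ Site.shift e.1 e.2 = x ∨ e.1 = y ∨ Site.shift e.1 e.2 =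
    y then W e else U e) = A U) → ∫⁻ U, ENNReal.ofReal (Ψ U ^ (1 + ε) * (‖fermionDet (wilsonDirac (fundamentalRep (Fin 3)) U (mq f) 1)‖ *
    (∏ g ∈ Finset.univ.erase f, ‖fermionDet (wilsonDirac (fundamentalRep (Fin 3)) U (mq g) 1)‖) * Real.exp (-(β * wilsonAction (fundamentalRep (Fin 3)) U)))) ∂(Measure.pi fun _ : Edge 4 L =>
    haarProbability SU3) ≤ ENNReal.ofReal K * ∫⁻ U, ENNReal.ofReal ((A U / ((∫ W, ‖fermionDet (wilsonDirac (fundamentalRep (Fin 3)) (fun e =>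
    if e.1 = x ∨ Site.shift e.1 e.2 = x ∨ e.1 = y ∨ Site.shift e.1 e.2 = y then W e else U e) (mq f) 1)‖ * (∏ g ∈ Finset.univ.erase f,
    ‖fermionDet (wilsonDirac (fundamentalRep (Fin 3)) (fun e => if e.1 = x ∨ Site.shift e.1 e.2 = x ∨ e.1 = y ∨ Site.shift e.1 e.2 =
    y then W e else U e) (mq g) 1)‖) * Real.exp (-(β * wilsonAction (fundamentalRep (Fin 3)) (fun e => if e.1 = x ∨ Site.shift e.1 e.2 =
    x ∨ e.1 = y ∨ Site.shift e.1 e.2 = y then W e else U e))) ∂(Measure.pi fun _ : Edge 4 L => haarProbability SU3)) /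
    ∫ W, (∏ g ∈ Finset.univ.erase f, ‖fermionDet (wilsonDirac (fundamentalRep (Fin 3)) (fun e => if e.1 = x ∨ Site.shift e.1 e.2 =
    x ∨ e.1 = y ∨ Site.shift e.1 e.2 = y then W e else U e) (mq g) 1)‖) * Real.exp (-(β * wilsonAction (fundamentalRep (Fin 3)) (fun e =>
    if e.1 = x ∨ Site.shift e.1 e.2 = x ∨ e.1 = y ∨ Site.shift e.1 e.2 = y then W e else U e))) ∂(Measure.pi fun _ : Edge 4 L =>
    haarProbability SU3))) ^ (1 + ε) * (‖fermionDet (wilsonDirac (fundamentalRep (Fin 3)) U (mq f) 1)‖ * (∏ g ∈ Finset.univ.erase f,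
    ‖fermionDet (wilsonDirac (fundamentalRep (Fin 3)) U (mq g) 1)‖) * Real.exp (-(β * wilsonAction (fundamentalRep (Fin 3)) U)))) ∂(Measure.pi fun _ : Edge 4 L =>
    haarProbability SU3) :=
  fibreMomentReduction


end Summit.QuantumFields.QCD.Cruxes.PhaseQuenchedFlavourDecay.CrossingSplitIntegrability

end
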